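import Mathlib
import HarnessLib

/-!
# `HeteroclinicTriggerChain` — crux `TriggerChainTable` (item stmt-NavierStokesRegularity-22786):
  the COMPLETE-TRANSFER ARC with two-sided hyperbolic rates (registered stub `stub_arc`)

For `e > 0` the three-mode pump-depletion system `ẋ = -e u²`, `u̇ = e x u - e u y`, `ẏ = e u²`
has the explicit heteroclinic orbit (logistic arc on `x + y = 1`, `u² = 2xy`)

  `x(t) = 1 / (1 + e^{2et})`, `u(t) = √2 · e^{et} / (1 + e^{2et})`, `y(t) = 1 - x(t)`,

running from the pure state `(1,0,0)` at `t = -∞` to the pure state `(0,0,1)` at `t = +∞`, with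
`|x - 1|, |u|, |y| ≤ 2 e^{et}` and `|u| ≥ e^{et}/2` for `t ≤ 0`, and `|x|, |u|, |y - 1| ≤ 2 e^{-et}`
for `t ≥ 0` (rates `κ = e`, constant `K = 2`). Placed on the three slots `(i₀,0) ↦ x`,
`(i₁,0) ↦ u`, `(i₀,1) ↦ y` of a family `H : Fin 4 → ℤ → ℝ → ℝ` (zero elsewhere) this is the
registered stub `stub_arc` of the crux skeleton, verbatim. The limits are obtained from the
exponential bounds by squeezing.

HONEST FRAMING: an elementary fact about an explicit solution of a three-dimensional quadratic
ODE (the connection clause of the MODEL-lattice design crux K2 of a line on class rung TL-M3).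
Nothing here is a statement about the Navier–Stokes equations; no summit and no rung is proved
by this file.
-/

noncomputable section

set_option linter.dupNamespace false

open Filter Topology

namespace Summit.NavierStokesRegularity.NavierStokesRegularity.Theorems.TriggerChainTable

/-- Squeeze at `-∞`: an exponential bound `|f t - L| ≤ K e^{et}` (`e > 0`) on `t ≤ 0` forces
`f → L` as `t → -∞`. [this file] -/
theorem heteroclinicTriggerChain_tendsto_atBot_of_exp_bound {f : ℝ → ℝ} {L K e : ℝ} (he : 0 < e)
    (h : ∀ t : ℝ, t ≤ 0 → |f t - L| ≤ K * Real.exp (e * t)) : Tendsto f atBot (𝓝 L) := by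
  have key : Tendsto (fun t => f t - L) atBot (𝓝 0) := by
    refine squeeze_zero_norm' (a := fun t => K * Real.exp (e * t))
      ((eventually_le_atBot (0 : ℝ)).mono fun t ht => ?_) ?_
    · simpa [Real.norm_eq_abs] using h t ht
    · have h1 : Tendsto (fun t : ℝ => e * t) atBot atBot := tendsto_id.const_mul_atBot he
      simpa using (Real.tendsto_exp_atBot.comp h1).const_mul K
  exact tendsto_sub_nhds_zero_iff.mp key

/-- Squeeze at `+∞`: an exponential bound `|f t - L| ≤ K e^{-κt}` (`κ > 0`) on `t ≥ 0` forces
`f → L` as `t → +∞`. [this file] -/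
theorem heteroclinicTriggerChain_tendsto_atTop_of_exp_bound {f : ℝ → ℝ} {L K κ : ℝ} (hκ : 0 < κ)
    (h : ∀ t : ℝ, 0 ≤ t → |f t - L| ≤ K * Real.exp (-(κ * t))) : Tendsto f atTop (𝓝 L) := by
  have key : Tendsto (fun t => f t - L) atTop (𝓝 0) := by
    refine squeeze_zero_norm' (a := fun t => K * Real.exp (-(κ * t)))
      ((eventually_ge_atTop (0 : ℝ)).mono fun t ht => ?_) ?_
    · simpa [Real.norm_eq_abs] using h t ht
    · have h1 : Tendsto (fun t : ℝ => -(κ * t)) atTop atBot :=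
        tendsto_neg_atTop_atBot.comp (tendsto_id.const_mul_atTop hκ)
      simpa using (Real.tendsto_exp_atBot.comp h1).const_mul K
  exact tendsto_sub_nhds_zero_iff.mp key

/-- The explicit logistic arc solves the pump-depletion system: derivatives of
`x = 1/(1+e^{2et})`, `u = √2 e^{et}/(1+e^{2et})`, `y = 1 - x`. [this file] -/
theorem heteroclinicTriggerChain_arc_hasDerivAt (e : ℝ) (t : ℝ) :
    HasDerivAt (fun s => (1 + Real.exp (2 * e * s))⁻¹)
      (-(e * (Real.sqrt 2 * Real.exp (e * t) / (1 + Real.exp (2 * e * t))) ^ 2)) t ∧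
    HasDerivAt (fun s => Real.sqrt 2 * Real.exp (e * s) / (1 + Real.exp (2 * e * s)))
      (e * (1 + Real.exp (2 * e * t))⁻¹ * (Real.sqrt 2 * Real.exp (e * t) / (1 + Real.exp (2 * e * t))) -
        e * (Real.sqrt 2 * Real.exp (e * t) / (1 + Real.exp (2 * e * t))) *
          (1 - (1 + Real.exp (2 * e * t))⁻¹)) t ∧
    HasDerivAt (fun s => 1 - (1 + Real.exp (2 * e * s))⁻¹)
      (e * (Real.sqrt 2 * Real.exp (e * t) / (1 + Real.exp (2 * e * t))) ^ 2) t := by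
  have hD : 0 < 1 + Real.exp (2 * e * t) := by positivity
  have hEE : Real.exp (e * t) ^ 2 = Real.exp (2 * e * t) := by
    rw [sq, ← Real.exp_add]; ring_nf
  have h2 : Real.sqrt 2 ^ 2 = 2 := Real.sq_sqrt (by norm_num)
  have hq : HasDerivAt (fun s => 1 + Real.exp (2 * e * s)) (Real.exp (2 * e * t) * (2 * e)) t := by
    simpa using (((hasDerivAt_id' t).const_mul (2 * e)).exp).const_add 1
  have hE : HasDerivAt (fun s => Real.sqrt 2 * Real.exp (e * s))
      (Real.sqrt 2 * (Real.exp (e * t) * e)) t := by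
    simpa using (((hasDerivAt_id' t).const_mul e).exp).const_mul (Real.sqrt 2)
  have hx : HasDerivAt (fun s => (1 + Real.exp (2 * e * s))⁻¹)
      (-(Real.exp (2 * e * t) * (2 * e)) / (1 + Real.exp (2 * e * t)) ^ 2) t := hq.fun_inv hD.ne'
  have hu := hE.fun_div hq hD.ne'
  refine ⟨hx.congr_deriv ?_, hu.congr_deriv ?_, ((hasDerivAt_const t (1 : ℝ)).sub hx).congr_deriv ?_⟩
  · rw [div_pow, mul_pow, h2, hEE]
    ring
  · field_simp
    ring
  · rw [div_pow, mul_pow, h2, hEE]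
    ring

/-- Exponential bounds of the arc at `t ≤ 0` (approach to the pure state `(1,0,0)` at rate `e`,
constant `2`, and the lower bound `|u| ≥ e^{et}/2`). [this file] -/
theorem heteroclinicTriggerChain_arc_bounds_nonpos (e t : ℝ) (he : 0 < e) (ht : t ≤ 0) :
    |(1 + Real.exp (2 * e * t))⁻¹ - 1| ≤ 2 * Real.exp (e * t) ∧
    |Real.sqrt 2 * Real.exp (e * t) / (1 + Real.exp (2 * e * t)) - 0| ≤ 2 * Real.exp (e * t) ∧
    |1 - (1 + Real.exp (2 * e * t))⁻¹ - 0| ≤ 2 * Real.exp (e * t) ∧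
    2⁻¹ * Real.exp (e * t) ≤ |Real.sqrt 2 * Real.exp (e * t) / (1 + Real.exp (2 * e * t))| := by
  have hEpos : 0 < Real.exp (e * t) := Real.exp_pos _
  have hqpos : 0 < Real.exp (2 * e * t) := Real.exp_pos _
  have hD : 0 < 1 + Real.exp (2 * e * t) := by positivity
  have hEE : Real.exp (e * t) ^ 2 = Real.exp (2 * e * t) := by
    rw [sq, ← Real.exp_add]; ring_nf
  have hE1 : Real.exp (e * t) ≤ 1 := Real.exp_le_one_iff.mpr (by nlinarith)
  have hqE : Real.exp (2 * e * t) ≤ Real.exp (e * t) := by rw [← hEE]; nlinarith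
  have hs0 : 0 ≤ Real.sqrt 2 := Real.sqrt_nonneg 2
  have hs2 : Real.sqrt 2 ^ 2 = 2 := Real.sq_sqrt (by norm_num)
  have hu0 : 0 ≤ Real.sqrt 2 * Real.exp (e * t) / (1 + Real.exp (2 * e * t)) := by positivity
  have hsq2 : Real.sqrt 2 ≤ 2 := by nlinarith
  have hsq1 : 1 ≤ Real.sqrt 2 := by nlinarith
  have hEq : 0 < Real.exp (e * t) * Real.exp (2 * e * t) := mul_pos hEpos hqpos
  refine ⟨?_, ?_, ?_, ?_⟩
  · rw [show (1 + Real.exp (2 * e * t))⁻¹ - 1 = -(1 - (1 + Real.exp (2 * e * t))⁻¹) by ring,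
      abs_neg, inv_eq_one_div, one_sub_div hD.ne', add_sub_cancel_left,
      abs_of_nonneg (by positivity), div_le_iff₀ hD]
    nlinarith
  · rw [sub_zero, abs_of_nonneg hu0, div_le_iff₀ hD]
    nlinarith
  · rw [sub_zero, inv_eq_one_div, one_sub_div hD.ne', add_sub_cancel_left,
      abs_of_nonneg (by positivity), div_le_iff₀ hD]
    nlinarith
  · rw [abs_of_nonneg hu0, le_div_iff₀ hD]
    nlinarith

/-- Exponential bounds of the arc at `t ≥ 0` (approach to the pure state `(0,0,1)` at rate
`κ = e`, constant `2`). [this file] -/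
theorem heteroclinicTriggerChain_arc_bounds_nonneg (e t : ℝ) (he : 0 < e) (ht : 0 ≤ t) :
    |(1 + Real.exp (2 * e * t))⁻¹ - 0| ≤ 2 * Real.exp (-(e * t)) ∧
    |Real.sqrt 2 * Real.exp (e * t) / (1 + Real.exp (2 * e * t)) - 0| ≤ 2 * Real.exp (-(e * t)) ∧
    |1 - (1 + Real.exp (2 * e * t))⁻¹ - 1| ≤ 2 * Real.exp (-(e * t)) := by
  have hEpos : 0 < Real.exp (e * t) := Real.exp_pos _
  have hFpos : 0 < Real.exp (-(e * t)) := Real.exp_pos _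
  have hqpos : 0 < Real.exp (2 * e * t) := Real.exp_pos _
  have hD : 0 < 1 + Real.exp (2 * e * t) := by positivity
  have hFq : Real.exp (-(e * t)) * Real.exp (2 * e * t) = Real.exp (e * t) := by
    rw [← Real.exp_add]; ring_nf
  have hE1 : 1 ≤ Real.exp (e * t) := Real.one_le_exp_iff.mpr (by positivity)
  have hs0 : 0 ≤ Real.sqrt 2 := Real.sqrt_nonneg 2
  have hs2 : Real.sqrt 2 ^ 2 = 2 := Real.sq_sqrt (by norm_num)
  have hu0 : 0 ≤ Real.sqrt 2 * Real.exp (e * t) / (1 + Real.exp (2 * e * t)) := by positivity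
  have hsq2 : Real.sqrt 2 ≤ 2 := by nlinarith
  have hFE : Real.exp (e * t) ≤ Real.exp (-(e * t)) * (1 + Real.exp (2 * e * t)) := by
    rw [mul_add, mul_one, hFq]; linarith [hFpos.le]
  refine ⟨?_, ?_, ?_⟩
  · rw [sub_zero, abs_of_nonneg (by positivity), inv_eq_one_div, div_le_iff₀ hD]
    nlinarith
  · rw [sub_zero, abs_of_nonneg hu0, div_le_iff₀ hD]
    nlinarith
  · rw [show (1 : ℝ) - (1 + Real.exp (2 * e * t))⁻¹ - 1 = -(1 + Real.exp (2 * e * t))⁻¹ by ring,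
      abs_neg, abs_of_nonneg (by positivity), inv_eq_one_div, div_le_iff₀ hD]
    nlinarith

/-- **Registered stub `stub_arc` of crux `TriggerChainTable` (item stmt-NavierStokesRegularity-22786),
verbatim.** For modes `i₀ ≠ i₁` and rate `e > 0`, the family carrying the explicit logistic arc
(module docstring) on the slots `(i₀,0), (i₁,0), (i₀,1)` and zero elsewhere solves
`ẋ = -eu²`, `u̇ = exu - euy`, `ẏ = eu²`, tends to the pure states `δ_{(i₀,0)}` / `δ_{(i₀,1)}` at
`∓∞`, obeys the two-sided exponential bounds with `κ = e`, `K = 2` (including the lower bound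
`K⁻¹e^{et} ≤ |u|` on `t ≤ 0`), and `x·u ≢ 0`. [this file] -/
theorem stub_arc : ∀ i₀ i₁ : Fin 4, i₀ ≠ i₁ → ∀ e : ℝ, 0 < e
    → ∃ κ K : ℝ, 0 < κ ∧ 0 < K ∧ ∃ H : Fin 4 → ℤ → ℝ → ℝ, (∀ (i : Fin 4) (n : ℤ) (t : ℝ), ¬((i =
    i₀ ∧ n = 0) ∨ (i = i₁ ∧ n = 0) ∨ (i = i₀ ∧ n = 1)) → H i n t = 0) ∧ (∀ t : ℝ, HasDerivAt (H i₀
    0) (-(e * H i₁ 0 t ^ 2)) t) ∧ (∀ t : ℝ, HasDerivAt (H i₁ 0) (e * H i₀ 0 t * H i₁ 0 t - e * H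
    i₁ 0 t * H i₀ 1 t) t) ∧ (∀ t : ℝ, HasDerivAt (H i₀ 1) (e * H i₁ 0 t ^ 2) t) ∧ (∀ i n,
    Filter.Tendsto (H i n) Filter.atBot (nhds (if i = i₀ ∧ n = 0 then (1 : ℝ) else 0))) ∧ (∀ i n,
    Filter.Tendsto (H i n) Filter.atTop (nhds (if i = i₀ ∧ n = 1 then (1 : ℝ) else 0))) ∧ (∀ i n
    t, t ≤ 0 → |H i n t - (if i = i₀ ∧ n = 0 then (1 : ℝ) else 0)| ≤ K * Real.exp (e * t)) ∧ (∀ t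
    : ℝ, t ≤ 0 → K⁻¹ * Real.exp (e * t) ≤ |H i₁ 0 t|) ∧ (∀ i n t, 0 ≤ t → |H i n t - (if i = i₀ ∧
    n = 1 then (1 : ℝ) else 0)| ≤ K * Real.exp (-(κ * t))) ∧ (∃ t : ℝ, H i₀ 0 t * H i₁ 0 t ≠ 0) :=
    by
  intro i₀ i₁ hne e he
  -- the three coordinates of the arc
  obtain ⟨x, hx⟩ : ∃ x : ℝ → ℝ, x = fun s => (1 + Real.exp (2 * e * s))⁻¹ := ⟨_, rfl⟩
  obtain ⟨u, hu⟩ : ∃ u : ℝ → ℝ, u =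
      fun s => Real.sqrt 2 * Real.exp (e * s) / (1 + Real.exp (2 * e * s)) := ⟨_, rfl⟩
  obtain ⟨y, hy⟩ : ∃ y : ℝ → ℝ, y = fun s => 1 - (1 + Real.exp (2 * e * s))⁻¹ := ⟨_, rfl⟩
  -- the family: `x, u, y` on the three slots, zero elsewhere
  obtain ⟨H, hH⟩ : ∃ H : Fin 4 → ℤ → ℝ → ℝ, H = fun (i : Fin 4) (n : ℤ) =>
      if i = i₀ ∧ n = 0 then x else if i = i₁ ∧ n = 0 then u else if i = i₀ ∧ n = 1 then y
      else 0 := ⟨_, rfl⟩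
  have hH0 : H i₀ 0 = x := by rw [hH]; simp
  have hH1 : H i₁ 0 = u := by rw [hH]; simp [hne.symm]
  have hH2 : H i₀ 1 = y := by rw [hH]; simp
  have hHz : ∀ (i : Fin 4) (n : ℤ), ¬((i = i₀ ∧ n = 0) ∨ (i = i₁ ∧ n = 0) ∨ (i = i₀ ∧ n = 1)) →
      H i n = 0 := by
    intro i n h
    rw [hH]
    dsimp only
    rw [if_neg (fun h' => h (Or.inl h')), if_neg (fun h' => h (Or.inr (Or.inl h'))),
      if_neg (fun h' => h (Or.inr (Or.inr h')))]
  -- derivatives and bounds of the coordinates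
  have hder := fun t => heteroclinicTriggerChain_arc_hasDerivAt e t
  have hbn := fun t (ht : t ≤ 0) => heteroclinicTriggerChain_arc_bounds_nonpos e t he ht
  have hbp := fun t (ht : 0 ≤ t) => heteroclinicTriggerChain_arc_bounds_nonneg e t he ht
  have hx1 : ∀ t : ℝ, t ≤ 0 → |x t - 1| ≤ 2 * Real.exp (e * t) := fun t ht => by
    rw [hx]; exact (hbn t ht).1
  have hu1 : ∀ t : ℝ, t ≤ 0 → |u t - 0| ≤ 2 * Real.exp (e * t) := fun t ht => by
    rw [hu]; exact (hbn t ht).2.1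
  have hy1 : ∀ t : ℝ, t ≤ 0 → |y t - 0| ≤ 2 * Real.exp (e * t) := fun t ht => by
    rw [hy]; exact (hbn t ht).2.2.1
  have hul : ∀ t : ℝ, t ≤ 0 → 2⁻¹ * Real.exp (e * t) ≤ |u t| := fun t ht => by
    rw [hu]; exact (hbn t ht).2.2.2
  have hx2 : ∀ t : ℝ, 0 ≤ t → |x t - 0| ≤ 2 * Real.exp (-(e * t)) := fun t ht => by
    rw [hx]; exact (hbp t ht).1
  have hu2 : ∀ t : ℝ, 0 ≤ t → |u t - 0| ≤ 2 * Real.exp (-(e * t)) := fun t ht => by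
    rw [hu]; exact (hbp t ht).2.1
  have hy2 : ∀ t : ℝ, 0 ≤ t → |y t - 1| ≤ 2 * Real.exp (-(e * t)) := fun t ht => by
    rw [hy]; exact (hbp t ht).2.2
  have hz1 : ∀ t : ℝ, t ≤ 0 → |(0 : ℝ → ℝ) t - 0| ≤ 2 * Real.exp (e * t) := fun t _ => by
    simp only [Pi.zero_apply, sub_self, abs_zero]; positivity
  have hz2 : ∀ t : ℝ, 0 ≤ t → |(0 : ℝ → ℝ) t - 0| ≤ 2 * Real.exp (-(e * t)) := fun t _ => by
    simp only [Pi.zero_apply, sub_self, abs_zero]; positivity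
  refine ⟨e, 2, he, two_pos, H, fun i n t h => by rw [hHz i n h]; rfl, fun t => ?_, fun t => ?_,
    fun t => ?_, fun i n => ?_, fun i n => ?_, fun i n t ht => ?_, fun t ht => ?_,
    fun i n t ht => ?_, ⟨0, ?_⟩⟩
  · -- `ẋ = -e u²`
    rw [hH0, hH1, hx, hu]; exact (hder t).1
  · -- `u̇ = e x u - e u y`
    rw [hH0, hH1, hH2, hx, hu, hy]; exact (hder t).2.1
  · -- `ẏ = e u²`
    rw [hH2, hH1, hy, hu]; exact (hder t).2.2
  · -- limits at `-∞`
    by_cases h1 : i = i₀ ∧ n = 0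
    · obtain ⟨rfl, rfl⟩ := h1
      rw [if_pos ⟨rfl, rfl⟩, hH0]
      exact heteroclinicTriggerChain_tendsto_atBot_of_exp_bound he hx1
    rw [if_neg h1]
    by_cases h2 : i = i₁ ∧ n = 0
    · obtain ⟨rfl, rfl⟩ := h2
      rw [hH1]
      exact heteroclinicTriggerChain_tendsto_atBot_of_exp_bound he hu1
    by_cases h3 : i = i₀ ∧ n = 1
    · obtain ⟨rfl, rfl⟩ := h3
      rw [hH2]
      exact heteroclinicTriggerChain_tendsto_atBot_of_exp_bound he hy1
    · rw [hHz i n (by tauto)]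
      exact tendsto_const_nhds
  · -- limits at `+∞`
    by_cases h1 : i = i₀ ∧ n = 0
    · obtain ⟨rfl, rfl⟩ := h1
      rw [if_neg (by simp), hH0]
      exact heteroclinicTriggerChain_tendsto_atTop_of_exp_bound he hx2
    by_cases h2 : i = i₁ ∧ n = 0
    · obtain ⟨rfl, rfl⟩ := h2
      rw [if_neg (by simp), hH1]
      exact heteroclinicTriggerChain_tendsto_atTop_of_exp_bound he hu2
    by_cases h3 : i = i₀ ∧ n = 1
    · obtain ⟨rfl, rfl⟩ := h3
      rw [if_pos ⟨rfl, rfl⟩, hH2]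
      exact heteroclinicTriggerChain_tendsto_atTop_of_exp_bound he hy2
    · rw [if_neg (fun h => h3 h), hHz i n (by tauto)]
      exact tendsto_const_nhds
  · -- rate `e` at `-∞`
    by_cases h1 : i = i₀ ∧ n = 0
    · obtain ⟨rfl, rfl⟩ := h1
      rw [if_pos ⟨rfl, rfl⟩, hH0]
      exact hx1 t ht
    rw [if_neg h1]
    by_cases h2 : i = i₁ ∧ n = 0
    · obtain ⟨rfl, rfl⟩ := h2
      rw [hH1]
      exact hu1 t ht
    by_cases h3 : i = i₀ ∧ n = 1
    · obtain ⟨rfl, rfl⟩ := h3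
      rw [hH2]
      exact hy1 t ht
    · rw [hHz i n (by tauto)]
      exact hz1 t ht
  · -- lower bound of the trigger coordinate at `-∞`
    rw [hH1]
    exact hul t ht
  · -- rate `κ = e` at `+∞`
    by_cases h1 : i = i₀ ∧ n = 0
    · obtain ⟨rfl, rfl⟩ := h1
      rw [if_neg (by simp), hH0]
      exact hx2 t ht
    by_cases h2 : i = i₁ ∧ n = 0
    · obtain ⟨rfl, rfl⟩ := h2
      rw [if_neg (by simp), hH1]
      exact hu2 t ht
    by_cases h3 : i = i₀ ∧ n = 1
    · obtain ⟨rfl, rfl⟩ := h3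
      rw [if_pos ⟨rfl, rfl⟩, hH2]
      exact hy2 t ht
    · rw [if_neg (fun h => h3 h), hHz i n (by tauto)]
      exact hz2 t ht
  · -- `x(0) u(0) = (1/2)(√2/2) ≠ 0`
    rw [hH0, hH1, hx, hu]
    have hs : Real.sqrt 2 ≠ 0 := by positivity
    norm_num [hs]

end Summit.NavierStokesRegularity.NavierStokesRegularity.Theorems.TriggerChainTable
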